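import Summits.BirchSwinnertonDyer.Uniform.UI.O2Binder
import HarnessLib

/-!
# Uniform/UI/O2 — the HEIGHT FORM of `TateSigmaIrrationalAtThree`

HONEST FRAMING (cell `bsd-uniform`, seat `ui-o2`, gen 3): THEOREMS ONLY about the CONJECTURE typed
in `Uniform/UI/O2.lean` (`TateSigmaIrrationalAtThree`, open, nothing asserted); no definition, no named
fact, no `sorry`; nothing here proves BSD for any curve, books anything or moves a census mark.

What this file adds: the conjecture of record, stated on the Tate–sigma VALUE `Σ²_E(P)`, is
EQUIVALENT to a statement about Stein–Wuthrich's canonical `3`-adic HEIGHT (4.1) alone —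

  `TateSigmaIrrationalAtThree ↔ (for every curve multiplicative at 3 and every admissible P,
   ĥ₃(P) ∉ log₃(ℚˣ))`,

i.e. the height of an admissible point is never the `3`-adic logarithm of a non-zero rational number
(`tateSigmaIrrationalAtThree_iff_height_notMem_log_rat`). Schneider's hypothesis at the point,
`ĥ₃(P) ≠ 0 = log₃ 1`, is the instance `s = 1`; the conjecture strengthens it by exactly the countable
exclusion set `log₃(ℚˣ) = log₃({rationals prime to 3}) ⊂ 3ℤ₃`. The proof is `heightFourOneCoord_eq`
(`ĥ = log₃ den x − log₃ Σ²`, by `rfl`) plus the RATIONAL kernel of `log₃` (`ker = ±3^ℤ ⊂ ℚˣ`,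
`exists_ratCast_eq_of_padicLog_eq_padicLog_ratCast`, the rational-argument form of gen 2's
`exists_ratCast_eq_of_padicLog_eq_padicLog_natCast`) and the junk value `log₃ 0 = 0`. This is the
dictionary the seat's falsifier uses (REG3 / σ-screen: PARI's regulator pins `log₃ Σ²`, hence `Σ²` up
to `±3^ℤ` — immaterial for rationality), now kernel-checked.
-/

open scoped Classical

namespace Summit.BirchSwinnertonDyer.Uniform.UI.O2

open WeierstrassCurve Literature.NumberTheory.EllipticCurves
open Literature.NumberTheory.EllipticCurves.SteinWuthrich2013
open Literature.NumberTheory.EllipticCurves.Rank1Residual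
open Summit.BirchSwinnertonDyer.Rank1Residual

/-- **The kernel of `log₃` is rational (rational-argument form).** If `b ∈ ℚ₃`, `b ≠ 0`, and
`log₃ b = log₃ s` for a rational `s ≠ 0`, then `b ∈ ℚ`: `log₃ (b/s) = 0`, so `b/s ∈ 3^ℤ · μ(ℚ₃) = ±3^ℤ`
(`padicLog_eq_zero_iff_holds`, `eq_one_or_eq_neg_one_of_pow_eq_one_padicThree`).
[cite: Iwasawa1972PadicL, §4.4] -/
theorem exists_ratCast_eq_of_padicLog_eq_padicLog_ratCast {b : ℚ_[3]} (hb : b ≠ 0) {s : ℚ}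
    (hs : s ≠ 0) (hlog : padicLog 3 b = padicLog 3 (s : ℚ_[3])) :
    ∃ r : ℚ, b = (r : ℚ_[3]) := by
  -- adapted from `exists_ratCast_eq_of_padicLog_eq_padicLog_natCast` (gen 2, O2Binder.lean)
  have hs3 : (s : ℚ_[3]) ≠ 0 := by exact_mod_cast hs
  set c : ℚ_[3] := b * (s : ℚ_[3])⁻¹ with hc_def
  have hc0 : c ≠ 0 := mul_ne_zero hb (inv_ne_zero hs3)
  have hinv : padicLog 3 ((s : ℚ_[3])⁻¹) = -padicLog 3 (s : ℚ_[3]) := by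
    have h := padicLog_mul_holds 3 (x := (s : ℚ_[3])) (y := (s : ℚ_[3])⁻¹) hs3 (inv_ne_zero hs3)
    rw [mul_inv_cancel₀ hs3, padicLog_three_one] at h
    linear_combination -h
  have hlogc : padicLog 3 c = 0 := by
    rw [hc_def, padicLog_mul_holds 3 hb (inv_ne_zero hs3), hinv, hlog, add_neg_cancel]
  obtain ⟨n, k, hk, hpow⟩ := (padicLog_eq_zero_iff_holds 3 hc0).mp hlogc
  have hw := eq_one_or_eq_neg_one_of_pow_eq_one_padicThree hk hpow
  have h3 : ((3 : ℕ) : ℚ_[3]) ≠ 0 := by exact_mod_cast (by norm_num : (3 : ℕ) ≠ 0)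
  have hc_eq : c = (c * ((3 : ℕ) : ℚ_[3]) ^ (-n)) * ((3 : ℕ) : ℚ_[3]) ^ n := by
    rw [mul_assoc, ← zpow_add₀ h3, neg_add_cancel, zpow_zero, mul_one]
  have hb_eq : b = c * (s : ℚ_[3]) := by
    rw [hc_def, mul_assoc, inv_mul_cancel₀ hs3, mul_one]
  rcases hw with h1 | h1
  · refine ⟨(3 : ℚ) ^ n * s, ?_⟩
    rw [hb_eq, hc_eq, h1, one_mul]
    push_cast
    ring
  · refine ⟨-(3 : ℚ) ^ n * s, ?_⟩
    rw [hb_eq, hc_eq, h1]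
    push_cast
    ring

/-- `log₃ (a / s) = log₃ a − log₃ s` for a rational `s ≠ 0` and `a ≠ 0` in `ℚ₃` (homomorphism
property `padicLog_mul_holds`). [cite: Iwasawa1972PadicL, §4.4] -/
theorem padicLog_div_ratCast {a : ℚ_[3]} (ha : a ≠ 0) {s : ℚ} (hs : s ≠ 0) :
    padicLog 3 (a * (s : ℚ_[3])⁻¹) = padicLog 3 a - padicLog 3 (s : ℚ_[3]) := by
  have hs3 : (s : ℚ_[3]) ≠ 0 := by exact_mod_cast hs
  have hinv : padicLog 3 ((s : ℚ_[3])⁻¹) = -padicLog 3 (s : ℚ_[3]) := by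
    have h := padicLog_mul_holds 3 (x := (s : ℚ_[3])) (y := (s : ℚ_[3])⁻¹) hs3 (inv_ne_zero hs3)
    rw [mul_inv_cancel₀ hs3, padicLog_three_one] at h
    linear_combination -h
  rw [padicLog_mul_holds 3 ha (inv_ne_zero hs3), hinv, sub_eq_add_neg]

/-- **HEIGHT FORM of the conjecture (equivalence).** `TateSigmaIrrationalAtThree` holds iff for every
globally minimal `W` multiplicative at `3`, Tate parameter `q`, and admissible point `P = (x, y)`, SW's
canonical height (4.1) `ĥ₃(P) = heightFourOneCoord W 3 q x y` is NOT the `3`-adic logarithm of a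
non-zero rational number: `∀ s : ℚ, s ≠ 0 → ĥ₃(P) ≠ log₃ s`. (`→`: `ĥ = log₃ s` gives
`log₃ Σ² = log₃ (den x / s)`, so `Σ² ∈ ℚ` by the rational kernel; `←`: `Σ² = r ∈ ℚ` gives
`ĥ = log₃ (den x / r)` for `r ≠ 0`, resp. `ĥ = log₃ (den x)` for `r = 0` since `log₃ 0 = 0`.)
Schneider's pointwise hypothesis `ĥ₃(P) ≠ 0` is the instance `s = 1`.
[cite: SteinWuthrich2013, §4.1 eq. (4.1), §4.2] [cite: Schneider1982PadicHeightI, §1]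
[cite: Bertrand1982, Cor. 4, Problème 1] -/
theorem tateSigmaIrrationalAtThree_iff_height_notMem_log_rat :
    TateSigmaIrrationalAtThree ↔
      ∀ (W : WeierstrassCurve ℚ) [W.IsElliptic] [W.IsGloballyMinimal], Mult W 3 →
        ∀ (q : ℚ_[3]), q ≠ 0 → ‖q‖ < 1 → tateJ q = (W.j : ℚ_[3]) →
        ∀ (x y : ℚ) (h : W.toAffine.Nonsingular x y), W.IsAdmissible 3 (.some x y h) →
          ∀ s : ℚ, s ≠ 0 → heightFourOneCoord W 3 q x y ≠ padicLog 3 (s : ℚ_[3]) := by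
  constructor
  · intro hC W _ _ hmult q hq0 hq1 hj x y hns hadm s hs heq
    have hirr : ∀ r : ℚ, tateSigmaValueSq W 3 q x y ≠ (r : ℚ_[3]) := by
      have h' := hC
      unfold TateSigmaIrrationalAtThree at h'
      exact h' W hmult q hq0 hq1 hj x y hns hadm
    have hb : tateSigmaValueSq W 3 q x y ≠ 0 := by
      intro h0
      exact hirr 0 (by rw [h0, Rat.cast_zero])
    have hden : (x.den : ℚ) ≠ 0 := by exact_mod_cast x.den_nz
    have hden3 : ((x.den : ℚ) : ℚ_[3]) ≠ 0 := by exact_mod_cast x.den_nz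
    rw [heightFourOneCoord_eq] at heq
    -- `log₃ Σ² = log₃ den − log₃ s = log₃ (den / s)`
    have hlog : padicLog 3 (tateSigmaValueSq W 3 q x y) =
        padicLog 3 (((x.den : ℚ) / s : ℚ) : ℚ_[3]) := by
      have hds : (((x.den : ℚ) / s : ℚ) : ℚ_[3]) = ((x.den : ℚ) : ℚ_[3]) * (s : ℚ_[3])⁻¹ := by
        push_cast
        ring
      rw [hds, padicLog_div_ratCast hden3 hs]
      linear_combination -heq
    obtain ⟨r, hr⟩ := exists_ratCast_eq_of_padicLog_eq_padicLog_ratCast hb (div_ne_zero hden hs) hlog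
    exact hirr r hr
  · intro H
    unfold TateSigmaIrrationalAtThree
    intro W _ _ hmult q hq0 hq1 hj x y hns hadm r heq
    have hden : (x.den : ℚ) ≠ 0 := by exact_mod_cast x.den_nz
    have hden3 : ((x.den : ℚ) : ℚ_[3]) ≠ 0 := by exact_mod_cast x.den_nz
    have hH := H W hmult q hq0 hq1 hj x y hns hadm
    by_cases hr : r = 0
    · -- `Σ² = 0`: `ĥ = log₃ den − log₃ 0 = log₃ den`
      apply hH (x.den : ℚ) hden
      rw [heightFourOneCoord_eq, heq, hr, Rat.cast_zero, padicLog_zero, sub_zero]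
    · -- `Σ² = r ≠ 0`: `ĥ = log₃ den − log₃ r = log₃ (den / r)`
      apply hH ((x.den : ℚ) / r) (div_ne_zero hden hr)
      have hds : (((x.den : ℚ) / r : ℚ) : ℚ_[3]) = ((x.den : ℚ) : ℚ_[3]) * (r : ℚ_[3])⁻¹ := by
        push_cast
        ring
      rw [heightFourOneCoord_eq, heq, hds, padicLog_div_ratCast hden3 hr]

/-- **Corollary (the pointwise content, restated through the height form).** Under the conjecture the
canonical height of an admissible point avoids the whole countable set `log₃(ℚˣ)`; in particular
(`s = 1`, `log₃ 1 = 0`) it is non-zero — gen 2's `heightFourOneCoord_ne_zero_of_tateSigmaIrrational`,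
recovered. [cite: SteinWuthrich2013, §4.2] [cite: Schneider1982PadicHeightI, §1] -/
theorem heightFourOneCoord_ne_padicLog_ratCast_of_tateSigmaIrrational
    (hC : TateSigmaIrrationalAtThree) (W : WeierstrassCurve ℚ) [W.IsElliptic] [W.IsGloballyMinimal]
    (hmult : Mult W 3) {q : ℚ_[3]} (hq0 : q ≠ 0) (hq1 : ‖q‖ < 1) (hj : tateJ q = (W.j : ℚ_[3]))
    {x y : ℚ} (hns : W.toAffine.Nonsingular x y) (hadm : W.IsAdmissible 3 (.some x y hns))
    {s : ℚ} (hs : s ≠ 0) :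
    heightFourOneCoord W 3 q x y ≠ padicLog 3 (s : ℚ_[3]) :=
  tateSigmaIrrationalAtThree_iff_height_notMem_log_rat.mp hC W hmult q hq0 hq1 hj x y hns hadm s hs

end Summit.BirchSwinnertonDyer.Uniform.UI.O2
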